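import Summits.CriticalPhenomena.PercolationContinuityZ3.Theorems.PercNearOneGluingNoHeavyLowerTailKnQuestion8CoefficientwiseHarrisTwice
import Summits.CriticalPhenomena.PercolationContinuityZ3.Theorems.PercNearOneGluingNoHeavyLowerTailKnQuestion8CoefficientwiseNoCoreDegTwo
import HarnessLib

/-!
# The hybrid-spin exclusion: `2·HYB = CROSS`, and the `{up blue, uq red}` class of `Q_mix(p,q)[1_u]` at a degree-two `u` — prim-lf-2 gen 50 (part 1 of 2)

Support file (`--supports stmt-CriticalPhenomena-4575`, closed), prover `prim-lf-2` (gen 50).  No definitions, no named facts, no sorries; standard axioms.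
Memo `prim-lf-2/CW-TWOSOURCE-gen50.md` §1 and `prim-lf-2/CW-ANATOMY-gen49.md` §3 (iii), §3.5; HANDOFF gen 49 §NEXT (3)–(4).

Setting.  Finite multigraph `ends : ι → Sym2 V`, root `x`, `K(s) = openCluster (ends '' s) x`, `ĝ(s) = g(K s) − g(K sᶜ)`, `σ_v = [v ∈ K s] − [v ∈ K sᶜ]`;
`NO-CORE(q)[1_p,g] = Σ_{s : ¬(q ∈ K s ∧ q ∈ K sᶜ)} σ_p ĝ`, `Q_mix(p,q)[1_u,g] = Σ_{s : ¬(p ∈ K s ∧ q ∈ K sᶜ)} σ_u ĝ` (CONJECTURES NO-CORE / Q_mix of gens 46–47).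
The HYBRID-SPIN exclusion of gen 49 is `HYB(p,q)[g] := Σ_t [¬(p ∈ K t ∧ q ∈ K tᶜ)]·([q ∈ K t] − [p ∈ K tᶜ])·ĝ(t)` — a two-point exclusion whose spin mixes the two points.
* `hybrid_eq_half_cross` — **the identity `HYB(p,q)[g] = ½·(NO-CORE(q)[1_p,g] + NO-CORE(p)[1_q,g])` for EVERY multigraph, root, `p, q` and EVERY `g`** (symmetrise `t ↔ tᶜ`,
  under which `ĝ ↦ −ĝ`, then a 16-case pointwise identity in the four indicators `[p∈Kt], [p∈Ktᶜ], [q∈Kt], [q∈Ktᶜ]`).  With THEOREM CROSS (gen 49, `noCore_cross_nonneg`: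
  the right side is `≥ 0` for monotone `g`) this signs HYB; part 2 (…QmixDegTwo, which imports the gen-49 modules) draws the consequences;
* `degTwo_blueRed_class_eq_hybrid` — for a vertex `u ∉ {x,p,q}` whose only edges are `i₁ = up ≠ i₂ = uq` and `g` ignoring `u`: the `u`-star class `{i₁ blue, i₂ red}` of
  `Q_mix(p,q)[1_u,g]` (in the sub-cube form of gen 49's `…QmixStarClass`: `a(r) = K(r⁺ ∪ {i₂})`, `b(r) = K((rᶜ)⁺ ∪ ({i₁,i₂} ∖ {i₂}))`) EQUALS `HYB(p,q)[g]` of the multigraph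
  `G − u` (edge type `{j // j ∉ {i₁,i₂}}`): `u` is a red leaf at `q` in `a(r)` (`[u ∈ a r] = [q ∈ K′r]`) and a blue leaf at `p` in `b(r)` (`[u ∈ b r] = [p ∈ K′rᶜ]`), by gen 48's
  pendant-edge lemma `openCluster_insert_leafEdge` twice; this is the 'deg-2 identity Q_uq = ½·CROSS^{G−u}' of CW-ANATOMY-gen49 §3 (iii), kernel-checked.
Exact pre-check (prim-lf-2 code/gen49/c/cross.c): `2·HYB = CROSS` as coefficient vectors on all graphs with ≤ 6 vertices (≤ 9 edges), all `(p,q)`.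
[cite: KozmaNitzan2024, Questions 8–9 (§5.5 p. 36) (context: the Question-8 pocket covariance programme)]
-/

namespace Summit.CriticalPhenomena.PercolationContinuityZ3.Theorems

open Finset Literature.Probability.Percolation

namespace Coefficientwise

variable {ι V : Type*} [Fintype ι] [DecidableEq ι] (ends : ι → Sym2 V) (x : V)

open Classical in
/-- **The hybrid-spin exclusion is half the CROSS sum** (pure bookkeeping, every `g`):
`Σ_t [¬(p ∈ K t ∧ q ∈ K tᶜ)]·([q ∈ K t] − [p ∈ K tᶜ])·ĝ(t) = ½·(Σ_{s : ¬(q∈Ks ∧ q∈Ksᶜ)} σ_p ĝ + Σ_{s : ¬(p∈Ks ∧ p∈Ksᶜ)} σ_q ĝ)`.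
Proof: average the summand over `t` and `tᶜ` (`ĝ(tᶜ) = −ĝ(t)`) and compare pointwise (16 cases of the four indicators).
[cite: KozmaNitzan2024, §5.5 (context only; bookkeeping)] -/
theorem hybrid_eq_half_cross (p q : V) (g : Set V → ℝ) :
    ∑ t : Finset ι, (if ¬ (p ∈ openCluster (ends '' (↑t : Set ι)) x ∧ q ∈ openCluster (ends '' (↑(tᶜ) : Set ι)) x) then
        ((if q ∈ openCluster (ends '' (↑t : Set ι)) x then (1 : ℝ) else 0) - (if p ∈ openCluster (ends '' (↑(tᶜ) : Set ι)) x then (1 : ℝ) else 0)) *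
          (g (openCluster (ends '' (↑t : Set ι)) x) - g (openCluster (ends '' (↑(tᶜ) : Set ι)) x))
      else 0) =
    (1 / 2 : ℝ) * (
      ∑ s ∈ univ.filter (fun s : Finset ι => ¬ (q ∈ openCluster (ends '' (↑s : Set ι)) x ∧ q ∈ openCluster (ends '' (↑(sᶜ) : Set ι)) x)),
        ((if p ∈ openCluster (ends '' (↑s : Set ι)) x then (1 : ℝ) else 0) - (if p ∈ openCluster (ends '' (↑(sᶜ) : Set ι)) x then (1 : ℝ) else 0)) *
          (g (openCluster (ends '' (↑s : Set ι)) x) - g (openCluster (ends '' (↑(sᶜ) : Set ι)) x))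
      + ∑ s ∈ univ.filter (fun s : Finset ι => ¬ (p ∈ openCluster (ends '' (↑s : Set ι)) x ∧ p ∈ openCluster (ends '' (↑(sᶜ) : Set ι)) x)),
        ((if q ∈ openCluster (ends '' (↑s : Set ι)) x then (1 : ℝ) else 0) - (if q ∈ openCluster (ends '' (↑(sᶜ) : Set ι)) x then (1 : ℝ) else 0)) *
          (g (openCluster (ends '' (↑s : Set ι)) x) - g (openCluster (ends '' (↑(sᶜ) : Set ι)) x))) := by
  set K : Finset ι → Set V := fun s => openCluster (ends '' (↑s : Set ι)) x with hK
  set gh : Finset ι → ℝ := fun s => g (K s) - g (K sᶜ) with hgh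
  set h : Finset ι → ℝ := fun t => (if ¬ (p ∈ K t ∧ q ∈ K tᶜ) then
      ((if q ∈ K t then (1 : ℝ) else 0) - (if p ∈ K tᶜ then (1 : ℝ) else 0)) * gh t else 0) with hh
  change ∑ t : Finset ι, h t = (1 / 2 : ℝ) * (
      ∑ s ∈ univ.filter (fun s : Finset ι => ¬ (q ∈ K s ∧ q ∈ K sᶜ)),
        ((if p ∈ K s then (1 : ℝ) else 0) - (if p ∈ K sᶜ then (1 : ℝ) else 0)) * gh s
      + ∑ s ∈ univ.filter (fun s : Finset ι => ¬ (p ∈ K s ∧ p ∈ K sᶜ)),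
        ((if q ∈ K s then (1 : ℝ) else 0) - (if q ∈ K sᶜ then (1 : ℝ) else 0)) * gh s)
  have hsym : ∑ t : Finset ι, h t = (1 / 2 : ℝ) * ∑ t : Finset ι, (h t + h tᶜ) := by
    rw [Finset.sum_add_distrib, sum_compl_eq h]; ring
  rw [hsym, Finset.sum_filter, Finset.sum_filter, ← Finset.sum_add_distrib]
  congr 1
  refine Finset.sum_congr rfl fun t _ => ?_
  have hg' : gh tᶜ = - gh t := by simp only [hgh, compl_compl]; ring
  have e1 : h t = (if ¬ (p ∈ K t ∧ q ∈ K tᶜ) then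
      ((if q ∈ K t then (1 : ℝ) else 0) - (if p ∈ K tᶜ then (1 : ℝ) else 0)) * gh t else 0) := rfl
  have e2 : h tᶜ = (if ¬ (p ∈ K tᶜ ∧ q ∈ K t) then
      ((if q ∈ K tᶜ then (1 : ℝ) else 0) - (if p ∈ K t then (1 : ℝ) else 0)) * (- gh t) else 0) := by
    simp only [hh, compl_compl, hg']
  rw [e1, e2]
  by_cases h1 : p ∈ K t <;> by_cases h2 : p ∈ K tᶜ <;> by_cases h3 : q ∈ K t <;> by_cases h4 : q ∈ K tᶜ <;>
    simp [h1, h2, h3, h4]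

section degtwo

variable {u p q : V} {i₁ i₂ : ι}

open Classical in
/-- **The `{up blue, uq red}` class of `Q_mix(p,q)[1_u,g]` at a degree-two `u` is the hybrid-spin exclusion of `G − u`.**  Let `u ∉ {x,p,q}` have exactly the edges `i₁ = up`,
`i₂ = uq` (`i₁ ≠ i₂`) and let `g` ignore `u`.  With `D = {i₁,i₂}`, `R = {i₂}`, `a(r) = K(r⁺ ∪ {i₂})`, `b(r) = K((rᶜ)⁺ ∪ (D ∖ {i₂}))` on the sub-cube `r : Finset {j // j ∉ D}`:
`Σ_r [¬(p ∈ a r ∧ q ∈ b r)]·([u ∈ a r] − [u ∈ b r])·(g(a r) − g(b r)) = Σ_r [¬(p ∈ K′r ∧ q ∈ K′rᶜ)]·([q ∈ K′r] − [p ∈ K′rᶜ])·(g(K′r) − g(K′rᶜ))`, `K′` the cluster of the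
multigraph with edge type `{j // j ∉ D}` — because `u` is a red leaf at `q` in `a(r)` and a blue leaf at `p` in `b(r)` (`openCluster_insert_leafEdge` twice).
[cite: KozmaNitzan2024, Questions 8–9 (§5.5 p. 36) (context)] -/
theorem degTwo_blueRed_class_eq_hybrid (hi₁ : ends i₁ = s(u, p)) (hi₂ : ends i₂ = s(u, q)) (hne : i₁ ≠ i₂)
    (hdeg : ∀ i, u ∈ ends i → i = i₁ ∨ i = i₂) (hpu : p ≠ u) (hqu : q ≠ u) (hxu : x ≠ u)
    (g : Set V → ℝ) (hgu : ∀ C : Set V, g (insert u C) = g C) :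
    ∑ r : Finset {j : ι // j ∉ ({i₁, i₂} : Finset ι)},
      (if ¬ (p ∈ openCluster (ends '' (↑(r.map (Function.Embedding.subtype _) ∪ {i₂}) : Set ι)) x ∧
              q ∈ openCluster (ends '' (↑(rᶜ.map (Function.Embedding.subtype _) ∪ (({i₁, i₂} : Finset ι) \ {i₂})) : Set ι)) x) then
        ((if u ∈ openCluster (ends '' (↑(r.map (Function.Embedding.subtype _) ∪ {i₂}) : Set ι)) x then (1 : ℝ) else 0) -
          (if u ∈ openCluster (ends '' (↑(rᶜ.map (Function.Embedding.subtype _) ∪ (({i₁, i₂} : Finset ι) \ {i₂})) : Set ι)) x then (1 : ℝ) else 0)) *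
        (g (openCluster (ends '' (↑(r.map (Function.Embedding.subtype _) ∪ {i₂}) : Set ι)) x) -
          g (openCluster (ends '' (↑(rᶜ.map (Function.Embedding.subtype _) ∪ (({i₁, i₂} : Finset ι) \ {i₂})) : Set ι)) x))
      else 0) =
    ∑ t : Finset {j : ι // j ∉ ({i₁, i₂} : Finset ι)},
      (if ¬ (p ∈ openCluster ((fun j : {j : ι // j ∉ ({i₁, i₂} : Finset ι)} => ends j.1) '' (↑t : Set {j : ι // j ∉ ({i₁, i₂} : Finset ι)})) x ∧
              q ∈ openCluster ((fun j : {j : ι // j ∉ ({i₁, i₂} : Finset ι)} => ends j.1) '' (↑(tᶜ) : Set {j : ι // j ∉ ({i₁, i₂} : Finset ι)})) x) then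
        ((if q ∈ openCluster ((fun j : {j : ι // j ∉ ({i₁, i₂} : Finset ι)} => ends j.1) '' (↑t : Set {j : ι // j ∉ ({i₁, i₂} : Finset ι)})) x then (1 : ℝ) else 0) -
          (if p ∈ openCluster ((fun j : {j : ι // j ∉ ({i₁, i₂} : Finset ι)} => ends j.1) '' (↑(tᶜ) : Set {j : ι // j ∉ ({i₁, i₂} : Finset ι)})) x then (1 : ℝ) else 0)) *
        (g (openCluster ((fun j : {j : ι // j ∉ ({i₁, i₂} : Finset ι)} => ends j.1) '' (↑t : Set {j : ι // j ∉ ({i₁, i₂} : Finset ι)})) x) -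
          g (openCluster ((fun j : {j : ι // j ∉ ({i₁, i₂} : Finset ι)} => ends j.1) '' (↑(tᶜ) : Set {j : ι // j ∉ ({i₁, i₂} : Finset ι)})) x))
      else 0) := by
  classical
  set D : Finset ι := {i₁, i₂} with hD
  set Pr : ι → Prop := fun j => j ∉ D with hPr
  set K : Finset ι → Set V := fun s => openCluster (ends '' (↑s : Set ι)) x with hK
  set emb := Function.Embedding.subtype Pr with hemb
  set K' : Finset {j : ι // Pr j} → Set V := fun t => openCluster ((fun j : {j : ι // Pr j} => ends j.1) '' (↑t : Set {j : ι // Pr j})) x with hK'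
  have hsd : D \ {i₂} = {i₁} := by
    ext a
    simp only [hD, Finset.mem_sdiff, Finset.mem_insert, Finset.mem_singleton]
    constructor
    · rintro ⟨(rfl | rfl), h⟩
      · rfl
      · exact absurd rfl h
    · rintro rfl; exact ⟨Or.inl rfl, hne⟩
  -- the sub-cube cluster is the cluster of the image colouring
  have hKT : ∀ t : Finset {j : ι // Pr j}, K' t = K (t.map emb) := by
    intro t
    simp only [hK', hK, Finset.coe_map, Set.image_image]
    rfl
  have hnoT : ∀ t : Finset {j : ι // Pr j}, ∀ i ∈ t.map emb, u ∉ ends i := by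
    intro t i hi hui
    obtain ⟨hP, _⟩ := (mem_map_subtype_iff Pr t i).mp hi
    rcases hdeg i hui with rfl | rfl
    · exact hP (by simp [hD])
    · exact hP (by simp [hD])
  have hins₂ : ∀ t : Finset {j : ι // Pr j}, t.map emb ∪ {i₂} = insert i₂ (t.map emb) := by
    intro t; rw [Finset.union_comm, ← Finset.insert_eq]
  have hins₁ : ∀ t : Finset {j : ι // Pr j}, t.map emb ∪ (D \ {i₂}) = insert i₁ (t.map emb) := by
    intro t; rw [hsd, Finset.union_comm, ← Finset.insert_eq]
  -- pendant facts: `u` is a red leaf at `q` in `a(r)` and a blue leaf at `p` in `b(r)`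
  have pend₂ : ∀ t : Finset {j : ι // Pr j},
      (∀ v, v ≠ u → (v ∈ K (insert i₂ (t.map emb)) ↔ v ∈ K' t)) ∧ (u ∈ K (insert i₂ (t.map emb)) ↔ q ∈ K' t) ∧ u ∉ K' t := by
    intro t; rw [hKT t]; exact openCluster_insert_leafEdge ends x (t.map emb) hi₂ hqu hxu (hnoT t)
  have pend₁ : ∀ t : Finset {j : ι // Pr j},
      (∀ v, v ≠ u → (v ∈ K (insert i₁ (t.map emb)) ↔ v ∈ K' t)) ∧ (u ∈ K (insert i₁ (t.map emb)) ↔ p ∈ K' t) ∧ u ∉ K' t := by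
    intro t; rw [hKT t]; exact openCluster_insert_leafEdge ends x (t.map emb) hi₁ hpu hxu (hnoT t)
  change ∑ r : Finset {j : ι // Pr j}, (if ¬ (p ∈ K (r.map emb ∪ {i₂}) ∧ q ∈ K (rᶜ.map emb ∪ (D \ {i₂}))) then
        ((if u ∈ K (r.map emb ∪ {i₂}) then (1 : ℝ) else 0) - (if u ∈ K (rᶜ.map emb ∪ (D \ {i₂})) then (1 : ℝ) else 0)) *
        (g (K (r.map emb ∪ {i₂})) - g (K (rᶜ.map emb ∪ (D \ {i₂})))) else 0) =
    ∑ t : Finset {j : ι // Pr j}, (if ¬ (p ∈ K' t ∧ q ∈ K' tᶜ) then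
        ((if q ∈ K' t then (1 : ℝ) else 0) - (if p ∈ K' tᶜ then (1 : ℝ) else 0)) * (g (K' t) - g (K' tᶜ)) else 0)
  refine Finset.sum_congr rfl fun r _ => ?_
  rw [hins₂ r, hins₁ rᶜ]
  obtain ⟨a2, b2, c2⟩ := pend₂ r
  obtain ⟨a1, b1, c1⟩ := pend₁ rᶜ
  have hp : p ∈ K (insert i₂ (r.map emb)) ↔ p ∈ K' r := a2 p hpu
  have hq : q ∈ K (insert i₁ (rᶜ.map emb)) ↔ q ∈ K' rᶜ := a1 q hqu
  have hg2 : g (K (insert i₂ (r.map emb))) = g (K' r) := apply_eq_of_agree_off g hgu a2 c2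
  have hg1 : g (K (insert i₁ (rᶜ.map emb))) = g (K' rᶜ) := apply_eq_of_agree_off g hgu a1 c1
  rw [hg2, hg1]
  simp only [hp, hq, b2, b1]

end degtwo

end Coefficientwise

end Summit.CriticalPhenomena.PercolationContinuityZ3.Theorems
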